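import Mathlib.Topology.Algebra.InfiniteSum.Real
import Mathlib.Topology.Algebra.InfiniteSum.NatInt
import Mathlib.Analysis.SpecificLimits.Basic
import Literature.Analysis.FluidPDE.FractionalNSReynoldsLimit
import HarnessLib

/-!
# The limit `q → ∞` of the Colombo–De Lellis–De Rosa iteration (proof of their Thm. 2.1)

Analysis/FluidPDE proofs-only file. Generic consequences of the estimates delivered by the
convex-integration iteration `ColomboDeLellisDeRosa2018_prop32`
(`FractionalNSPrescribedEnergyIteration.lean`) for ONE energy profile: a sequence of smooth
triples `(v_q, p_q, R_q)` on `[0,T₀] × 𝕋³` with summable sup-norm increments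
`‖v_{q+1} - v_q‖₀ ≤ A_q`, vanishing stress and the energy estimate (35). Following the proof of
Thm. 2.1 of the source (§3.2, p. 8: "`{(v_q, p_q)}` converge uniformly to a pair of continuous
functions `(v,p)` such that (7) holds … for every `ϑ < 1/(2bc)`, `v_q` converges in `C^ϑ`") we
prove, for a pointwise limit `u` of the `v_q` (in the application the pointwise `limUnder`, so
that the limit is a FUNCTION of the profile; no definition is introduced here):

* `tendsto_limUnder_of_norm_sub_succ_le`, `norm_sub_lim_le`, `exists_forall_norm_sub_lim_le` —
  existence of the limit and UNIFORM convergence on `[0,T₀] × 𝕋³` with the tail bound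
  `‖v_q - u‖ ≤ ∑_{m} A_{q+m}`;
* `norm_lim_le` — the sup bound `‖u‖ ≤ ‖v_0‖₀ + ∑ A_q`;
* `norm_lim_sub_le` — increments of the limit are bounded by the summed increments of the
  approximants (used with Hölder-type bounds `K_q d(x,y)^ϑ`);
* `continuousOn_uncurry_lim` — continuity on the closed slab (with the bridge
  `Torus.continuousOn_uncurry_of_continuousOn_stLift` from continuity of the space–time lift, via
  `IsOpenQuotientMap.continuousOn_comp_iff`);
* `isWeakFracNSSolutionOn_lim` — the limit solves the fractional Navier–Stokes system
  distributionally (`Torus.isWeakFracNSSolutionOn_of_unifLimit` of `FractionalNSReynoldsLimit`);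
* `integral_norm_sq_lim` — the energy identity `∫‖u(t)‖² = e(t)` from (35);
* `norm_le_mul_rpow_of_le_of_le_mul` — the elementary interpolation "sup bound `P` and
  Lipschitz-type bound `P r` give `P r^ϑ`" behind `[f]_ϑ ≤ C‖f‖₀^{1-ϑ}[f]₁^ϑ` (§10 (101)).

## References

* M. Colombo, C. De Lellis, L. De Rosa, Comm. Math. Phys. 362 (2018) (held: arXiv:1708.05666),
  §3.2 proof of Thm. 2.1 (p. 8); §10 (99)–(101). [`ColomboDelellisDerosa2018`]
-/

noncomputable section

open MeasureTheory Set Filter Function Topology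
open scoped ENNReal NNReal

namespace Literature.Analysis.FluidPDE

/-! ## Elementary interpolation -/

section Interpolation

variable {G : Type*} [SeminormedAddCommGroup G]

/-- **Interpolation between a sup bound and a Lipschitz-type bound.** If `‖g‖ ≤ P` and
`‖g‖ ≤ P r` with `P, r ≥ 0`, then `‖g‖ ≤ P r^ϑ` for every `0 ≤ ϑ ≤ 1` (for `r ≤ 1` use
`r ≤ r^ϑ`, for `r ≥ 1` use `1 ≤ r^ϑ`); applied to `g = f x - f y`, `r = L d(x,y)/P` this is the
interpolation `[f]_ϑ ≤ C ‖f‖₀^{1-ϑ} [f]₁^ϑ` of Colombo–De Lellis–De Rosa 2018, §10 (101). [folklore] -/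
theorem norm_le_mul_rpow_of_le_of_le_mul {g : G} {P r ϑ : ℝ} (hP : 0 ≤ P) (hr : 0 ≤ r)
    (hϑ0 : 0 ≤ ϑ) (hϑ1 : ϑ ≤ 1) (h0 : ‖g‖ ≤ P) (h1 : ‖g‖ ≤ P * r) : ‖g‖ ≤ P * r ^ ϑ := by
  rcases le_or_gt 1 r with hr1 | hr1
  · exact h0.trans (le_mul_of_one_le_right hP (Real.one_le_rpow hr1 hϑ0))
  · rcases hr.eq_or_lt with rfl | hr0
    · rcases hϑ0.eq_or_lt with rfl | hϑ0'
      · rw [Real.rpow_zero, mul_one]; exact h0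
      · rw [Real.zero_rpow hϑ0'.ne']; simpa using h1
    · refine h1.trans (mul_le_mul_of_nonneg_left ?_ hP)
      calc r = r ^ (1 : ℝ) := (Real.rpow_one r).symm
        _ ≤ r ^ ϑ := Real.rpow_le_rpow_of_exponent_ge hr0 hr1.le hϑ1

end Interpolation

/-! ## Pointwise limits of sequences with summable increments -/

section Limit

variable {X G : Type*} [NormedAddCommGroup G]

variable {w : ℕ → ℝ → X → G} {u : ℝ → X → G} {A : ℕ → ℝ} {S : Set ℝ}

/-- Under summable increments `‖w_{q+1} - w_q‖ ≤ A_q` on `S × X` (and completeness of the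
target), the sequence converges pointwise on `S × X` to its `limUnder` (the limit of the
convex-integration scheme, taken pointwise so that it is a FUNCTION of the data; Colombo–De
Lellis–De Rosa 2018, §3.2 and §8.3). [cite: ColomboDelellisDerosa2018, §3.2, proof of Thm. 2.1] -/
theorem tendsto_limUnder_of_norm_sub_succ_le [CompleteSpace G] (hA : Summable A)
    (h : ∀ q, ∀ t ∈ S, ∀ x, ‖w (q + 1) t x - w q t x‖ ≤ A q) {t : ℝ} (ht : t ∈ S) (x : X) :
    Tendsto (fun q => w q t x) atTop (𝓝 (limUnder atTop fun q => w q t x)) := by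
  have hc : CauchySeq fun q => w q t x :=
    cauchySeq_of_dist_le_of_summable A (fun n => by
      rw [dist_eq_norm, ← norm_neg, neg_sub]; exact h n t ht x) hA
  exact hc.tendsto_limUnder

/-- The tail bound `‖w_q - u‖ ≤ ∑_m A_{q+m}` on `S × X` for a pointwise limit `u`. [folklore] -/
theorem norm_sub_lim_le (hA : Summable A) (h : ∀ q, ∀ t ∈ S, ∀ x, ‖w (q + 1) t x - w q t x‖ ≤ A q)
    (hu : ∀ t ∈ S, ∀ x, Tendsto (fun q => w q t x) atTop (𝓝 (u t x)))
    (q : ℕ) {t : ℝ} (ht : t ∈ S) (x : X) : ‖w q t x - u t x‖ ≤ ∑' m, A (q + m) := by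
  have hf : ∀ n, dist (w n t x) (w (n + 1) t x) ≤ A n := fun n => by
    rw [dist_eq_norm, ← norm_neg, neg_sub]; exact h n t ht x
  have := dist_le_tsum_of_dist_le_of_tendsto A hf hA (hu t ht x) q
  rwa [dist_eq_norm] at this

/-- UNIFORM convergence on `S × X`: for every `ε > 0`, eventually `‖w_q - u‖ ≤ ε` on `S × X`
(the tails of a summable series tend to `0`). [folklore] -/
theorem exists_forall_norm_sub_lim_le (hA : Summable A)
    (h : ∀ q, ∀ t ∈ S, ∀ x, ‖w (q + 1) t x - w q t x‖ ≤ A q)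
    (hu : ∀ t ∈ S, ∀ x, Tendsto (fun q => w q t x) atTop (𝓝 (u t x))) :
    ∀ ε > 0, ∃ N, ∀ q ≥ N, ∀ t ∈ S, ∀ x, ‖w q t x - u t x‖ ≤ ε := by
  intro ε hε
  have htail : Tendsto (fun q => ∑' m, A (q + m)) atTop (𝓝 0) := by
    have := tendsto_sum_nat_add A
    refine this.congr fun q => ?_
    exact tsum_congr fun m => by rw [add_comm]
  obtain ⟨N, hN⟩ := Metric.tendsto_atTop.1 htail ε hε
  refine ⟨N, fun q hq t ht x => (norm_sub_lim_le hA h hu q ht x).trans ?_⟩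
  have := hN q hq
  rw [Real.dist_0_eq_abs] at this
  exact (le_abs_self _).trans this.le

/-- Sup bound of the approximants: `‖w_q‖ ≤ M₀ + ∑ A` on `S × X` if `‖w_0‖ ≤ M₀` there. [folklore] -/
theorem norm_apply_le_of_norm_sub_succ_le (hA : Summable A)
    (h : ∀ q, ∀ t ∈ S, ∀ x, ‖w (q + 1) t x - w q t x‖ ≤ A q) {M₀ : ℝ}
    (h0 : ∀ t ∈ S, ∀ x, ‖w 0 t x‖ ≤ M₀) (q : ℕ) {t : ℝ} (ht : t ∈ S) (x : X) :
    ‖w q t x‖ ≤ M₀ + ∑' m, A m := by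
  have hA0 : ∀ m, 0 ≤ A m := fun m => (norm_nonneg _).trans (h m t ht x)
  have hind : ∀ n, ‖w n t x‖ ≤ M₀ + ∑ m ∈ Finset.range n, A m := by
    intro n
    induction n with
    | zero => simpa using h0 t ht x
    | succ n ih =>
        calc ‖w (n + 1) t x‖ = ‖(w (n + 1) t x - w n t x) + w n t x‖ := by rw [sub_add_cancel]
          _ ≤ ‖w (n + 1) t x - w n t x‖ + ‖w n t x‖ := norm_add_le _ _
          _ ≤ A n + (M₀ + ∑ m ∈ Finset.range n, A m) := add_le_add (h n t ht x) ih
          _ = M₀ + ∑ m ∈ Finset.range (n + 1), A m := by rw [Finset.sum_range_succ]; ring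
  exact (hind q).trans (add_le_add le_rfl (hA.sum_le_tsum _ fun m _ => hA0 m))

/-- Sup bound of the limit: `‖u‖ ≤ M₀ + ∑ A` on `S × X` if `‖w_0‖ ≤ M₀` there. [folklore] -/
theorem norm_lim_le (hA : Summable A) (h : ∀ q, ∀ t ∈ S, ∀ x, ‖w (q + 1) t x - w q t x‖ ≤ A q)
    (hu : ∀ t ∈ S, ∀ x, Tendsto (fun q => w q t x) atTop (𝓝 (u t x)))
    {M₀ : ℝ} (h0 : ∀ t ∈ S, ∀ x, ‖w 0 t x‖ ≤ M₀) {t : ℝ} (ht : t ∈ S) (x : X) :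
    ‖u t x‖ ≤ M₀ + ∑' m, A m := by
  have h1 := norm_sub_lim_le hA h hu 0 ht x
  simp only [zero_add] at h1
  calc ‖u t x‖ = ‖w 0 t x - (w 0 t x - u t x)‖ := by rw [sub_sub_cancel]
    _ ≤ ‖w 0 t x‖ + ‖w 0 t x - u t x‖ := norm_sub_le _ _
    _ ≤ M₀ + ∑' m, A m := add_le_add (h0 t ht x) h1

/-- Increments of the limit: if `‖w_0(t,x) - w_0(t,y)‖ ≤ K₀ ρ` and the increments satisfy
`‖(w_{q+1} - w_q)(t,x) - (w_{q+1} - w_q)(t,y)‖ ≤ K_q ρ` with `∑ K_q < ∞`, then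
`‖u(t,x) - u(t,y)‖ ≤ (K₀ + ∑ K_q) ρ` (used with `ρ = d(x,y)^ϑ`: the limit inherits the summed
Hölder bounds). [folklore] -/
theorem norm_lim_sub_le (hu : ∀ t ∈ S, ∀ x, Tendsto (fun q => w q t x) atTop (𝓝 (u t x)))
    {t : ℝ} (ht : t ∈ S) {x y : X} {K : ℕ → ℝ} {K₀ ρ : ℝ} (hK : Summable K) (hρ : 0 ≤ ρ)
    (h0 : ‖w 0 t x - w 0 t y‖ ≤ K₀ * ρ)
    (hq : ∀ q, ‖(w (q + 1) t x - w q t x) - (w (q + 1) t y - w q t y)‖ ≤ K q * ρ) :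
    ‖u t x - u t y‖ ≤ (K₀ + ∑' q, K q) * ρ := by
  have hK0 : ∀ q, 0 ≤ K q * ρ := fun q => (norm_nonneg _).trans (hq q)
  have hind : ∀ n, ‖w n t x - w n t y‖ ≤ (K₀ + ∑ q ∈ Finset.range n, K q) * ρ := by
    intro n
    induction n with
    | zero => simpa using h0
    | succ n ih =>
        have e : w (n + 1) t x - w (n + 1) t y =
            ((w (n + 1) t x - w n t x) - (w (n + 1) t y - w n t y)) + (w n t x - w n t y) := by abel
        calc ‖w (n + 1) t x - w (n + 1) t y‖
            ≤ ‖(w (n + 1) t x - w n t x) - (w (n + 1) t y - w n t y)‖ + ‖w n t x - w n t y‖ := by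
              rw [e]; exact norm_add_le _ _
          _ ≤ K n * ρ + (K₀ + ∑ q ∈ Finset.range n, K q) * ρ := add_le_add (hq n) ih
          _ = (K₀ + ∑ q ∈ Finset.range (n + 1), K q) * ρ := by rw [Finset.sum_range_succ]; ring
  have hsum : ∀ n, (∑ q ∈ Finset.range n, K q) * ρ ≤ (∑' q, K q) * ρ := by
    intro n
    rcases hρ.eq_or_lt with rfl | hρ'
    · simp
    · have hKq : ∀ q, 0 ≤ K q := fun q => nonneg_of_mul_nonneg_left (hK0 q) hρ'
      exact mul_le_mul_of_nonneg_right (hK.sum_le_tsum _ fun q _ => hKq q) hρ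
  have hlim : Tendsto (fun n => ‖w n t x - w n t y‖) atTop (𝓝 ‖u t x - u t y‖) :=
    ((hu t ht x).sub (hu t ht y)).norm
  refine le_of_tendsto hlim (Eventually.of_forall fun n => (hind n).trans ?_)
  calc (K₀ + ∑ q ∈ Finset.range n, K q) * ρ = K₀ * ρ + (∑ q ∈ Finset.range n, K q) * ρ := by ring
    _ ≤ K₀ * ρ + (∑' q, K q) * ρ := add_le_add le_rfl (hsum n)
    _ = (K₀ + ∑' q, K q) * ρ := by ring

end Limit

/-! ## Continuity on `S × T^d` from continuity of the space–time lift -/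

section Uncurry

/-- For an open quotient map `f`, continuity of `g ∘ f` within `f ⁻¹' s` at `x` is continuity of
`g` within `s` at `f x` (the neighbourhood filters correspond under `map f`). [folklore] -/
theorem _root_.IsOpenQuotientMap.continuousWithinAt_comp_iff {X Y Z : Type*} [TopologicalSpace X]
    [TopologicalSpace Y] [TopologicalSpace Z] {f : X → Y} (h : IsOpenQuotientMap f) {g : Y → Z}
    {s : Set Y} {x : X} :
    ContinuousWithinAt (g ∘ f) (f ⁻¹' s) x ↔ ContinuousWithinAt g s (f x) := by
  simp only [ContinuousWithinAt, nhdsWithin, ← h.map_nhds_eq, ← Filter.map_inf_principal_preimage,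
    tendsto_map'_iff, comp_def]

/-- For an open quotient map `f`, `g` is continuous on `s` iff `g ∘ f` is continuous on
`f ⁻¹' s`. [folklore] -/
theorem _root_.IsOpenQuotientMap.continuousOn_comp_iff {X Y Z : Type*} [TopologicalSpace X]
    [TopologicalSpace Y] [TopologicalSpace Z] {f : X → Y} (h : IsOpenQuotientMap f) {g : Y → Z}
    {s : Set Y} :
    ContinuousOn (g ∘ f) (f ⁻¹' s) ↔ ContinuousOn g s := by
  constructor
  · intro hc y hy
    obtain ⟨x, rfl⟩ := h.surjective y
    exact h.continuousWithinAt_comp_iff.1 (hc x hy)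
  · intro hc x hx
    exact h.continuousWithinAt_comp_iff.2 (hc (f x) hx)

/-- A field `u : ℝ → T^d → F` whose space–time lift `(t, y) ↦ u t (proj y)` is continuous on
`S × ℝ^d` is jointly continuous on `S × T^d` (`id × proj` is an open quotient map,
`Torus.isOpenQuotientMap_proj`; cf. the global `Torus.continuous_uncurry_of_continuous_stLift`).
[folklore] -/
theorem Torus.continuousOn_uncurry_of_continuousOn_stLift {d : Type*} {F : Type*} [TopologicalSpace F]
    {S : Set ℝ} {u : ℝ → UnitAddTorus d → F}
    (hu : ContinuousOn (FunctionSpaces.Torus.stLift u) (S ×ˢ univ)) :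
    ContinuousOn (uncurry u) (S ×ˢ univ) := by
  have hq : IsOpenQuotientMap (Prod.map id FunctionSpaces.Torus.proj : ℝ × EuclideanSpace ℝ d → ℝ × UnitAddTorus d) :=
    IsOpenQuotientMap.id.prodMap FunctionSpaces.Torus.isOpenQuotientMap_proj
  have hpre : (Prod.map id FunctionSpaces.Torus.proj : ℝ × EuclideanSpace ℝ d → ℝ × UnitAddTorus d) ⁻¹' (S ×ˢ univ) =
      S ×ˢ univ := by
    ext p; simp [mem_prod]
  have hcomp : uncurry u ∘ (Prod.map id FunctionSpaces.Torus.proj : ℝ × EuclideanSpace ℝ d → ℝ × UnitAddTorus d) =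
      FunctionSpaces.Torus.stLift u := by
    funext p; rfl
  rw [← hq.continuousOn_comp_iff, hpre, hcomp]
  exact hu

end Uncurry

/-! ## The limit of the scheme on the torus -/

section Torus

variable {d : Type*} [Fintype d] [DecidableEq d]

variable {v : ℕ → ℝ → UnitAddTorus d → EuclideanSpace ℝ d} {p : ℕ → ℝ → UnitAddTorus d → ℝ}
  {R : ℕ → ℝ → UnitAddTorus d → d → EuclideanSpace ℝ d} {u : ℝ → UnitAddTorus d → EuclideanSpace ℝ d}
  {A δ : ℕ → ℝ} {T₀ α : ℝ}

omit [DecidableEq d] in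
/-- The limit of the scheme is continuous on the closed slab `[0,T₀] × T^d` (uniform limit of
the jointly smooth `v_q`). [cite: ColomboDelellisDerosa2018, §3.2, proof of Thm. 2.1] -/
theorem continuousOn_uncurry_lim (hA : Summable A)
    (h : ∀ q, ∀ t ∈ Icc 0 T₀, ∀ x, ‖v (q + 1) t x - v q t x‖ ≤ A q)
    (hu : ∀ t ∈ Icc 0 T₀, ∀ x, Tendsto (fun q => v q t x) atTop (𝓝 (u t x)))
    (hs : ∀ q, FunctionSpaces.Torus.IsSmoothSpaceTimeOn (Icc 0 T₀) (v q)) :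
    ContinuousOn (uncurry u) (Icc 0 T₀ ×ˢ univ) :=
  Torus.continuousOn_uncurry_of_continuousOn_stLift
    (Torus.continuousOn_stLift_of_unifLimit (fun q => (hs q).continuousOn_stLift)
      (exists_forall_norm_sub_lim_le hA h hu))

/-- **The limit solves the fractional Navier–Stokes system** (Colombo–De Lellis–De Rosa 2018,
§3: "(27), (29) and (31) will imply the convergence of the sequence `v_q` to a continuous weak
solution"): if the `(v_q, p_q, R_q)` solve the fractional Navier–Stokes–Reynolds system on
`[0,T₀] × T^d` with summable sup increments and `‖R_q‖₀ ≤ δ_q → 0`, then the pointwise limit `u`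
is a distributional solution on `T^d × (0,T₀)` (`Torus.isWeakFracNSSolutionOn_of_unifLimit`).
[cite: ColomboDelellisDerosa2018, §3 p. 6 and §3.2] -/
theorem isWeakFracNSSolutionOn_lim (hT₀ : 0 < T₀) (hα : 0 ≤ α) (hA : Summable A)
    (h : ∀ q, ∀ t ∈ Icc 0 T₀, ∀ x, ‖v (q + 1) t x - v q t x‖ ≤ A q)
    (hu : ∀ t ∈ Icc 0 T₀, ∀ x, Tendsto (fun q => v q t x) atTop (𝓝 (u t x)))
    (hsol : ∀ q, Torus.IsFracNSReynoldsOn (Icc 0 T₀) α 1 (v q) (p q) (R q))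
    (hR : ∀ q, ∀ t ∈ Icc 0 T₀, ∀ x, ‖R q t x‖ ≤ δ q) (hδ : Tendsto δ atTop (𝓝 0)) :
    Torus.IsWeakFracNSSolutionOn T₀ α 1 u := by
  refine Torus.isWeakFracNSSolutionOn_of_unifLimit hT₀ hα hsol
    (exists_forall_norm_sub_lim_le hA h hu) fun ε hε => ?_
  obtain ⟨N, hN⟩ := Metric.tendsto_atTop.1 hδ ε hε
  refine ⟨N, fun q hq t ht x => (hR q t ht x).trans ?_⟩
  have := hN q hq
  rw [Real.dist_0_eq_abs] at this
  exact (le_abs_self _).trans this.le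

omit [DecidableEq d] in
/-- **The energy identity in the limit** (Colombo–De Lellis–De Rosa 2018, §3 (35) ⇒ (7)): if
`|E(1-δ_q) - ∫‖v_q(t)‖²| ≤ ¼δ_q E` with `δ_q → 0`, the slices `v_q(t)` are continuous, uniformly
bounded, and converge to `u(t)` (uniformly), then `∫‖u(t)‖² = E` (dominated convergence).
[cite: ColomboDelellisDerosa2018, §3 (35) and §3.2] -/
theorem integral_norm_sq_lim (hA : Summable A)
    (h : ∀ q, ∀ t ∈ Icc 0 T₀, ∀ x, ‖v (q + 1) t x - v q t x‖ ≤ A q)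
    (hu : ∀ t ∈ Icc 0 T₀, ∀ x, Tendsto (fun q => v q t x) atTop (𝓝 (u t x)))
    (hs : ∀ q, FunctionSpaces.Torus.IsSmoothSpaceTimeOn (Icc 0 T₀) (v q))
    {M₀ : ℝ} (h0 : ∀ t ∈ Icc 0 T₀, ∀ x, ‖v 0 t x‖ ≤ M₀)
    {t : ℝ} (ht : t ∈ Icc 0 T₀) {E : ℝ}
    (hE : ∀ q, |E * (1 - δ q) - ∫ x, ‖v q t x‖ ^ 2| ≤ 1 / 4 * δ q * E) (hδ : Tendsto δ atTop (𝓝 0)) :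
    ∫ x, ‖u t x‖ ^ 2 = E := by
  have hB := norm_apply_le_of_norm_sub_succ_le hA h h0
  set B : ℝ := M₀ + ∑' m, A m with hB_def
  have hvc : ∀ q, Continuous (v q t) := fun q => ((hs q).isSmooth_slice ht).continuous
  -- `∫‖v_q(t)‖² → ∫‖u(t)‖²` by dominated convergence with the constant bound `B²`
  have hF : Tendsto (fun q => ∫ x, ‖v q t x‖ ^ 2) atTop (𝓝 (∫ x, ‖u t x‖ ^ 2)) := by
    refine tendsto_integral_of_dominated_convergence (fun _ => B ^ 2)
      (fun q => ((hvc q).norm.pow 2).aestronglyMeasurable) (integrable_const _)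
      (fun q => ae_of_all _ fun x => ?_) (ae_of_all _ fun x => ?_)
    · rw [Real.norm_eq_abs, abs_pow, abs_norm]
      exact pow_le_pow_left₀ (norm_nonneg _) (hB q ht x) 2
    · exact ((hu t ht x).norm).pow 2
  -- `E(1-δ_q) → E` and the two sequences are `¼δ_qE`-close
  have hG : Tendsto (fun q => E * (1 - δ q)) atTop (𝓝 E) := by
    have : Tendsto (fun q => E * (1 - δ q)) atTop (𝓝 (E * (1 - 0))) :=
      tendsto_const_nhds.mul (tendsto_const_nhds.sub hδ)
    simpa using this
  have hdiff : Tendsto (fun q => E * (1 - δ q) - ∫ x, ‖v q t x‖ ^ 2) atTop (𝓝 0) := by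
    have hb : Tendsto (fun q => 1 / 4 * δ q * E) atTop (𝓝 0) := by
      have : Tendsto (fun q => 1 / 4 * δ q * E) atTop (𝓝 (1 / 4 * 0 * E)) :=
        (tendsto_const_nhds.mul hδ).mul tendsto_const_nhds
      simpa using this
    refine squeeze_zero_norm (fun q => ?_) hb
    rw [Real.norm_eq_abs]
    exact hE q
  have hF' : Tendsto (fun q => ∫ x, ‖v q t x‖ ^ 2) atTop (𝓝 E) := by
    have := hG.sub hdiff
    simpa using this
  exact tendsto_nhds_unique hF hF'

end Torus

end Literature.Analysis.FluidPDE
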